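import Summits.CriticalPhenomena.PercolationContinuityZ3.Theorems.PercNearOneGluingNoHeavyLowerTailQ44VertexCoverLaw
import Summits.CriticalPhenomena.PercolationContinuityZ3.Theorems.PercNearOneGluingNoHeavyLowerTailQ44TTConeStarOpsW

/-!
# Conjecture W (`2·Q44 ≥ 0`) holds on the vertex-cover class, for all `n` (law level)

Support file for crux `stmt-CriticalPhenomena-4575` (row `W = 2·Q44` of the master family), seat `prim-bnk-1` gen 40; memo
`run/shared/lean/prim/prim-l12/FROM-prim-bnk-1-gen40-FIBRE-BRIDGE.md`.  Step (iv), the instantiation of the generic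
vertex-cover bridge `VCCone.sum_kernel_cell_nonneg_of_vertexCover` (`…Q44VertexCoverLaw`) for the kernel `kerW = kerQ44 + kerQ44ᵀ`:
the good tables are those mapping `kerW` into the 35-ray terminal-edge cone (`VCCone.tactList_botbot_nonneg_W`,
`…Q44TTConeUniversal`); star tables are good by the 81 accepted certificates `VCCone.inCone_starOp_W` (`…Q44TTConeStarOpsW`) via
the table identity `starTab_eq_starOpW`, and free terminal-pair tables are the generators `gadget 0…5`, good by the invariance
certificate `VCCone.invariant_W` (`…Q44VertexCoverConeW`).

**THEOREM (`q44_cells_of_vertexCover`).**  For every `n`, every weight `w : Sym2 (Fin n) → [0,1]` and all pairwise distinct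
marked points `a b c y` such that `w {u,v} = 0` whenever `u, v ∉ {a,b,c,y}` (the marked points form a vertex cover of the support
of `w`; e.g. every weighted `K_{2,m}`-, `K_{3,m}`-, `K_{4,m}`-type graph with arbitrary extra terminal–terminal edges):
`2(c₁₁c₉ + c₁₁c₈ + c₆c₈ + c₆c₁ + c₁c₈) + (c₂c₁₃ + c₁c₁₃ + c₅c₁₂ + c₁c₁₂ + c₆c₁₀ + c₆c₇ + c₂c₁₀ + c₅c₇) ≤ 2(c₁₁ + c₁₄)c₀`,
i.e. CONJECTURE W (`prim-nh-lead-4575` INEQ-CLAIMS; `TwoCopyMono.sum_kerQ44_cell` form) on this class.  ALSO: the general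
socket `sum_kerW_cell_nonneg_of_goodBlocks` (any labelling of the support into blocks sharing only terminals whose block tables map
`kerW` into the cone ⟹ W for that graph) (the open statement `BlockTDW` and `BlockTDW → W ∀ graphs` are in `…Q44BlockTDSocket`).  No sorries, no named facts, no definitions;
standard axioms + `Lean.ofReduceBool` (the two table identities by `native_decide` — computational; the cited certificates likewise).
-/

namespace Summit.CriticalPhenomena.PercolationContinuityZ3.Theorems

namespace VCCone

open TwoCopyMono FourPointAtoms Literature.Probability.Percolation

variable {n : ℕ}

/-- **Table identity**: the star table of `(A, F)` is the listed star operator `starOpW (starIdx A F)` (finite check). [this work] -/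
theorem starTab_eq_starOpW : ∀ A F : Finset (Fin 4), Disjoint A F → ∀ s t : Fin 15,
    starTab A F s t = starOpW (starIdx A F) s t := by
  native_decide

/-- **Table identity**: the free terminal-pair table of `{k, k'}` (`k ≠ k'`) is the generator table `gadget (pidx k k')`
(finite check). [this work] -/
theorem pairTab_eq_gadget : ∀ k k' : Fin 4, k ≠ k' → ∀ s t : Fin 15,
    pairTab k k' s t = gadget ⟨(pidx k k').1, lt_trans (pidx k k').2 (by decide)⟩ s t := by
  native_decide

/-- Star tables map `kerW` into the `W` cone. [this work] -/
theorem inCone_starTab_W (A F : Finset (Fin 4)) (h : Disjoint A F) : InCone raysW (tact (starTab A F) kerW) := by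
  have e : starTab A F = starOpW (starIdx A F) := funext fun s => funext fun t => starTab_eq_starOpW A F h s t
  rw [e]
  exact inCone_starOp_W _

/-- Free terminal-pair tables map `kerW` into the `W` cone. [this work] -/
theorem inCone_pairTab_W (k k' : Fin 4) (h : k ≠ k') : InCone raysW (tact (pairTab k k') kerW) := by
  have e : pairTab k k' = gadget ⟨(pidx k k').1, lt_trans (pidx k k').2 (by decide)⟩ :=
    funext fun s => funext fun t => pairTab_eq_gadget k k' h s t
  rw [e, ← act_eq_tact]
  exact inCone_act raysW invariant_W inCone_kerW _

/-- From the kernel form to the explicit row: `Σ kerWᵢⱼ cᵢ cⱼ = 2·Σ kerQ44ᵢⱼ cᵢ cⱼ = 4·Q44(c)`. [this work] -/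
theorem q44_cells_of_kerW_form (w : Sym2 (Fin n) → unitInterval) (a b c y : Fin n)
    (h : 0 ≤ ∑ i : Fin 15, ∑ j : Fin 15, (kerW i j : ℝ) * cell w a b c y i * cell w a b c y j) :
    2 * (cell w a b c y 11 * cell w a b c y 9 + cell w a b c y 11 * cell w a b c y 8 + cell w a b c y 6 * cell w a b c y 8 +
        cell w a b c y 6 * cell w a b c y 1 + cell w a b c y 1 * cell w a b c y 8) +
      (cell w a b c y 2 * cell w a b c y 13 + cell w a b c y 1 * cell w a b c y 13 + cell w a b c y 5 * cell w a b c y 12 +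
        cell w a b c y 1 * cell w a b c y 12 + cell w a b c y 6 * cell w a b c y 10 + cell w a b c y 6 * cell w a b c y 7 +
        cell w a b c y 2 * cell w a b c y 10 + cell w a b c y 5 * cell w a b c y 7) ≤
      2 * ((cell w a b c y 11 + cell w a b c y 14) * cell w a b c y 0) := by
  have hsplit : ∀ i j : Fin 15, (kerW i j : ℝ) * cell w a b c y i * cell w a b c y j =
      (kerQ44 i j : ℝ) * cell w a b c y i * cell w a b c y j + (kerQ44 j i : ℝ) * cell w a b c y i * cell w a b c y j := by
    intro i j; unfold kerW; push_cast; ring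
  simp_rw [hsplit, Finset.sum_add_distrib] at h
  have hT : (∑ i : Fin 15, ∑ j : Fin 15, (kerQ44 j i : ℝ) * cell w a b c y i * cell w a b c y j) =
      ∑ i : Fin 15, ∑ j : Fin 15, (kerQ44 i j : ℝ) * cell w a b c y i * cell w a b c y j := by
    rw [Finset.sum_comm]
    exact Finset.sum_congr rfl fun i _ => Finset.sum_congr rfl fun j _ => by ring
  rw [hT, sum_kerQ44_cell] at h
  linarith

/-- **Kernel form: `Σ kerWᵢⱼ cellᵢ cellⱼ ≥ 0` on the vertex-cover class**, all `n`. [this work] -/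
theorem sum_kerW_cell_nonneg_of_vertexCover (a b c y : Fin n) (hq : Function.Injective (quad a b c y))
    (w : Sym2 (Fin n) → unitInterval)
    (hVC : ∀ u v : Fin n, (∀ k, quad a b c y k ≠ u) → (∀ k, quad a b c y k ≠ v) → (w s(u, v) : ℝ) = 0) :
    0 ≤ ∑ i : Fin 15, ∑ j : Fin 15, (kerW i j : ℝ) * cell w a b c y i * cell w a b c y j :=
  sum_kernel_cell_nonneg_of_vertexCover a b c y hq kerW (fun G => InCone raysW (tact G kerW))
    (fun Gs hGs => tactList_botbot_nonneg_W Gs hGs []) inCone_starTab_W inCone_pairTab_W w hVC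

/-- **CONJECTURE W ON THE VERTEX-COVER CLASS (all `n`).**  For pairwise distinct marked points `a b c y` of a finite weighted
graph whose weight vanishes on all pairs of non-marked vertices:
`2(c₁₁c₉ + c₁₁c₈ + c₆c₈ + c₆c₁ + c₁c₈) + (c₂c₁₃ + c₁c₁₃ + c₅c₁₂ + c₁c₁₂ + c₆c₁₀ + c₆c₇ + c₂c₁₀ + c₅c₇) ≤ 2(c₁₁ + c₁₄)·c₀`
(cells indexed as `FourPointAtoms.pat4`: `0 a|b|c|y, 1 a|b|cy, 2 a|by|c, 5 ac|b|y, 6 ab|c|y, 7 a|bcy, 8 ay|bc, 9 ac|by, 10 acy|b,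
11 ab|cy, 12 aby|c, 13 abc|y, 14 abcy`). [this work] -/
theorem q44_cells_of_vertexCover (a b c y : Fin n) (hq : Function.Injective (quad a b c y))
    (w : Sym2 (Fin n) → unitInterval)
    (hVC : ∀ u v : Fin n, (∀ k, quad a b c y k ≠ u) → (∀ k, quad a b c y k ≠ v) → (w s(u, v) : ℝ) = 0) :
    2 * (cell w a b c y 11 * cell w a b c y 9 + cell w a b c y 11 * cell w a b c y 8 + cell w a b c y 6 * cell w a b c y 8 +
        cell w a b c y 6 * cell w a b c y 1 + cell w a b c y 1 * cell w a b c y 8) +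
      (cell w a b c y 2 * cell w a b c y 13 + cell w a b c y 1 * cell w a b c y 13 + cell w a b c y 5 * cell w a b c y 12 +
        cell w a b c y 1 * cell w a b c y 12 + cell w a b c y 6 * cell w a b c y 10 + cell w a b c y 6 * cell w a b c y 7 +
        cell w a b c y 2 * cell w a b c y 10 + cell w a b c y 5 * cell w a b c y 7) ≤
      2 * ((cell w a b c y 11 + cell w a b c y 14) * cell w a b c y 0) :=
  q44_cells_of_kerW_form w a b c y (sum_kerW_cell_nonneg_of_vertexCover a b c y hq w hVC)

/-- **General socket: block TT-dominance ⟹ Conjecture W, law level.**  For ANY finite weighted graph and pairwise distinct marked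
points: if the pairs of nonzero weight are labelled (`blk`) so that pairs with different labels share only marked vertices (e.g. label
= internal connected component of the support), and every block table of every supported fibre maps `kerW` into the 35-ray `W` cone
(the seat's conjecture TD, memo gen 39 §1; certified for all blocks with ≤ 4 internal vertices), then `Σ kerWᵢⱼ cellᵢ cellⱼ ≥ 0`,
i.e. Conjecture W for that graph. [this work] -/
theorem sum_kerW_cell_nonneg_of_goodBlocks (a b c y : Fin n) (hq : Function.Injective (quad a b c y))
    (w : Sym2 (Fin n) → unitInterval) {β : Type*} [DecidableEq β] (blk : Sym2 (Fin n) → β)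
    (hsep : ∀ e e' : Sym2 (Fin n), (w e : ℝ) ≠ 0 → (w e' : ℝ) ≠ 0 → blk e ≠ blk e' →
      ∀ v : Fin n, v ∈ e → v ∈ e' → ∃ k, quad a b c y k = v)
    (hgood : ∀ M C : Finset (Sym2 (Fin n)), Disjoint C M → (∀ e ∈ C ∪ M, (w e : ℝ) ≠ 0) →
      ∀ l ∈ (M ∪ C).image blk,
        InCone raysW (tact (blockTab a b c y (M.filter fun e => blk e = l) (C.filter fun e => blk e = l)) kerW)) :
    0 ≤ ∑ i : Fin 15, ∑ j : Fin 15, (kerW i j : ℝ) * cell w a b c y i * cell w a b c y j := by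
  classical
  apply sum_kernel_cell_nonneg_of_supported_fibres a b c y w
  intro M C hCM hsupp
  have hL : ∀ T ∈ M.powerset, liftK kerW (prof a b c y ↑(C ∪ T)) (prof a b c y ↑(C ∪ (M \ T))) =
      kerW (cellOf a b c y ↑(C ∪ T)) (cellOf a b c y ↑(C ∪ (M \ T))) := fun T _ => liftK_prof kerW a b c y _ _
  rw [Finset.sum_congr rfl hL]
  have hsep' : ∀ e ∈ M ∪ C, ∀ e' ∈ M ∪ C, blk e ≠ blk e' → ∀ v : Fin n, v ∈ e → v ∈ e' → ∃ k, quad a b c y k = v :=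
    fun e he e' he' hne => hsep e e' (hsupp e (by rwa [Finset.union_comm] at he))
      (hsupp e' (by rwa [Finset.union_comm] at he')) hne
  rw [fibre_factor a b c y blk ((M ∪ C).image blk).toList kerW M C (Finset.nodup_toList _)
    (fun e he => Finset.mem_toList.2 (Finset.mem_image_of_mem _ he)) hsep', cellOf_empty a b c y hq]
  refine tactList_botbot_nonneg_W _ (fun G hG => ?_) []
  obtain ⟨l, hl, rfl⟩ := List.mem_map.1 hG
  exact hgood M C hCM hsupp l (Finset.mem_toList.1 hl)

end VCCone

end Summit.CriticalPhenomena.PercolationContinuityZ3.Theorems
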